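import Literature.Computability.Complexity.ClosedFewMinterms
import Literature.Computability.Complexity.HarnikRazTest
import Literature.Computability.Complexity.MonotoneApproximation
import Mathlib.Algebra.Order.Field.GeomSum
import HarnessLib

/-!
# The approximators of Cavalar–Kumar–Rossman (§2.6) and their error bounds (Lemmas 2.16–2.18)

The instance of Razborov's method used by Cavalar–Kumar–Rossman for the Harnik–Raz function
(Algorithmica 84 (2022), §2.6–2.7): approximators are the trimmings of closed up-sets,
`𝒜 = {trim(cl(f))}`, with `f ⊔ g = trim(cl(f ∨ g))`, `f ⊓ g = trim(cl(f ∧ g))`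
(`CKR.scheme`, an `ApproxScheme` in the sense of `MonotoneApproximation.lean`), and the
per-gate error bounds fed into `ApproxScheme.exists_approx_circuit`:

* negative test inputs (uniform `𝐍`, weight `2^{-n}`): an approximate gate gains at most
  `ε · #{A : |A| ≤ c}` (CKR Lemma 2.10 — `sum_gainedSup_le`, `sum_gainedInf_le`);
* positive test inputs (`𝐘 = x_{S_v}`, `v : Fin c → 𝔽_n`, weight `n^{-c}`): under the
  parameter hypothesis `2 B log(c/ε) · k/n ≤ 1/3` (CKR §2.7: `(6Bc log n) · (k/n) ≤ 1/3`), an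
  approximate gate loses at most `½ · 3^{-⌊c/2⌋}` (CKR Lemmas 2.16/2.18 — `sum_lostSup_le`,
  `sum_lostInf_le`, through `sum_lost_le` and the minterm count of Lemma 2.11,
  `sum_card_filter_subset_hrSet_le`);
* **CKR Lemma 2.17** (approximators make many errors): `Pr[𝒜(𝐘) = 1] ≤ 1/2` unless `𝒜 ≡ 1`
  (`sum_filter_mem_le_half`).

## References

* B. P. Cavalar, M. Kumar, B. Rossman, *Monotone circuit lower bounds from robust sunflowers*,
  Algorithmica 84 (2022), §2.6–2.7, Lemmas 2.15–2.18 [CavalarKumarRossman2022].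
-/

namespace Literature.Computability.Complexity.CKR

open Finset Razborov Literature.Combinatorics.SetFamily

section Scheme

variable {V : Type*} [Fintype V] [DecidableEq V] {c : ℕ} {ε : ℝ}

/-- For `c ≥ 2` the input up-sets are trimmed: `trim(x_i) = x_i` (CKR §2.6: "every input is
closed and trivially trimmed"). [cite: CavalarKumarRossman2022, §2.6] -/
theorem trim_containing (hc : 2 ≤ c) (i : V) : trim c (containing i) = containing i := by
  ext B
  rw [mem_trim, minimals_containing, mem_containing]
  constructor
  · rintro ⟨A, hA, -, hAB⟩
    rw [mem_singleton] at hA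
    subst hA
    exact hAB (mem_singleton_self i)
  · intro hi
    exact ⟨{i}, mem_singleton_self _, by rw [card_singleton]; omega, singleton_subset_iff.2 hi⟩

/-- **The approximators** (CKR §2.6): `𝒜 = {trim(cl(f)) : f monotone}` — the trimmings of the
closed up-sets. [cite: CavalarKumarRossman2022, §2.6] -/
def IsApprox (c : ℕ) (ε : ℝ) (𝒜 : Finset (Finset V)) : Prop :=
  ∃ 𝒯 : Finset (Finset V), IsUpperSet (𝒯 : Set (Finset V)) ∧ IsClosedFam c ε 𝒯 ∧ 𝒜 = trim c 𝒯

/-- Approximators are up-sets. [cite: CavalarKumarRossman2022, §2.6] -/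
theorem IsApprox.isUpperSet {𝒜 : Finset (Finset V)} (h : IsApprox c ε 𝒜) :
    IsUpperSet (𝒜 : Set (Finset V)) := by
  obtain ⟨𝒯, -, -, rfl⟩ := h
  exact isUpperSet_trim c 𝒯

/-- Approximators are trimmed: their minterms have size `≤ c/2`. [cite: CavalarKumarRossman2022, §2.6] -/
theorem IsApprox.card_le_of_mem_minimals {𝒜 : Finset (Finset V)} (h : IsApprox c ε 𝒜)
    {A : Finset V} (hA : A ∈ minimals 𝒜) : #A ≤ c / 2 := by
  obtain ⟨𝒯, -, -, rfl⟩ := h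
  exact (minimals_trim hA).2

/-- `trim(cl(𝒮))` is an approximator. [cite: CavalarKumarRossman2022, §2.6] -/
theorem isApprox_trim_closure (c : ℕ) (ε : ℝ) (𝒮 : Finset (Finset V)) :
    IsApprox c ε (trim c (closure c ε 𝒮)) :=
  ⟨closure c ε 𝒮, isUpperSet_closure c ε 𝒮, isClosedFam_closure c ε 𝒮, rfl⟩

/-- **The approximation scheme of Cavalar–Kumar–Rossman** (§2.6): approximators `IsApprox`,
semantics "the support of the input lies in the up-set", `f ⊔ g = trim(cl(f ∨ g))`,
`f ⊓ g = trim(cl(f ∧ g))`, inputs `x_i ↦ {A : i ∈ A}` (closed for `ε ≤ 1/2`, trimmed for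
`c ≥ 2`). [cite: CavalarKumarRossman2022, §2.6] -/
noncomputable def scheme (c : ℕ) (ε : ℝ) (hc : 2 ≤ c) (hε : ε ≤ 1 / 2) :
    ApproxScheme V (Finset (Finset V)) where
  ok := IsApprox c ε
  val 𝒜 x := decide (finsetEquivFun.symm x ∈ 𝒜)
  sup 𝒜 ℬ := trim c (closure c ε (𝒜 ∪ ℬ))
  inf 𝒜 ℬ := trim c (closure c ε (𝒜 ∩ ℬ))
  inp i := containing i
  ok_inp i := ⟨containing i, isUpperSet_containing i, isClosedFam_containing hε c i,
    (trim_containing hc i).symm⟩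
  ok_sup 𝒜 ℬ _ _ := isApprox_trim_closure c ε _
  ok_inf 𝒜 ℬ _ _ := isApprox_trim_closure c ε _
  val_inp i x := by simp

/-- The semantics of the scheme on an input given by its support. [cite: CavalarKumarRossman2022, §2.6] -/
@[simp] theorem scheme_val_finsetEquivFun (hc : 2 ≤ c) (hε : ε ≤ 1 / 2) (𝒜 : Finset (Finset V))
    (U : Finset V) : (scheme c ε hc hε).val 𝒜 (finsetEquivFun U) = decide (U ∈ 𝒜) := by
  simp [scheme]

/-! ### Errors on the negative test inputs (CKR Lemma 2.10 per gate) -/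

/-- **An approximate OR gains little negative weight**: the uniform inputs rejected by `𝒜 ∨ ℬ`
but accepted by `𝒜 ⊔ ℬ = trim(cl(𝒜 ∪ ℬ))` have probability `≤ ε · #{A : |A| ≤ c}`
(CKR Lemma 2.10 and proof of Lemma 2.18). [cite: CavalarKumarRossman2022, Lemma 2.18] -/
theorem sum_gainedSup_le (hc : 2 ≤ c) (hε : ε ≤ 1 / 2) (hε0 : 0 ≤ ε) {𝒜 ℬ : Finset (Finset V)}
    (h𝒜 : IsApprox c ε 𝒜) (hℬ : IsApprox c ε ℬ) :
    ∑ _U ∈ (scheme c ε hc hε).gainedSup univ finsetEquivFun 𝒜 ℬ, (1 / 2 ^ Fintype.card V : ℝ)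
      ≤ ε * #(univ.filter fun A : Finset V => #A ≤ c) := by
  have hup : IsUpperSet ((𝒜 ∪ ℬ : Finset (Finset V)) : Set (Finset V)) := by
    rw [coe_union]; exact h𝒜.isUpperSet.union hℬ.isUpperSet
  refine le_trans ?_ (prHalf_not_mem_and_mem_closure_le hε0 (𝒜 ∪ ℬ) hup)
  rw [ApproxScheme.gainedSup, sum_const, nsmul_eq_mul, mul_one_div, prHalf]
  refine div_le_div_of_nonneg_right ?_ (by positivity)
  refine Nat.cast_le.2 (card_le_card (monotone_filter_right _ fun _ _ hU => ?_))
  simp only [scheme_val_finsetEquivFun, Bool.or_eq_false_iff, decide_eq_false_iff_not,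
    decide_eq_true_eq] at hU
  obtain ⟨⟨h1, h2⟩, h3⟩ := hU
  refine ⟨fun h => ?_, trim_subset (isUpperSet_closure c ε _) h3⟩
  rcases mem_union.1 h with h | h
  · exact h1 h
  · exact h2 h

/-- **An approximate AND gains little negative weight** (CKR Lemma 2.10 and proof of
Lemma 2.18). [cite: CavalarKumarRossman2022, Lemma 2.18] -/
theorem sum_gainedInf_le (hc : 2 ≤ c) (hε : ε ≤ 1 / 2) (hε0 : 0 ≤ ε) {𝒜 ℬ : Finset (Finset V)}
    (h𝒜 : IsApprox c ε 𝒜) (hℬ : IsApprox c ε ℬ) :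
    ∑ _U ∈ (scheme c ε hc hε).gainedInf univ finsetEquivFun 𝒜 ℬ, (1 / 2 ^ Fintype.card V : ℝ)
      ≤ ε * #(univ.filter fun A : Finset V => #A ≤ c) := by
  have hup : IsUpperSet ((𝒜 ∩ ℬ : Finset (Finset V)) : Set (Finset V)) := by
    rw [coe_inter]; exact h𝒜.isUpperSet.inter hℬ.isUpperSet
  refine le_trans ?_ (prHalf_not_mem_and_mem_closure_le hε0 (𝒜 ∩ ℬ) hup)
  rw [ApproxScheme.gainedInf, sum_const, nsmul_eq_mul, mul_one_div, prHalf]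
  refine div_le_div_of_nonneg_right ?_ (by positivity)
  refine Nat.cast_le.2 (card_le_card (monotone_filter_right _ fun _ _ hU => ?_))
  simp only [scheme_val_finsetEquivFun, Bool.and_eq_false_iff, decide_eq_false_iff_not,
    decide_eq_true_eq] at hU
  obtain ⟨h12, h3⟩ := hU
  refine ⟨fun h => ?_, trim_subset (isUpperSet_closure c ε _) h3⟩
  rcases h12 with h' | h'
  · exact h' (mem_inter.1 h).1
  · exact h' (mem_inter.1 h).2

/-- The minterms of `𝒜 ∨ ℬ` and of `𝒜 ∧ ℬ` of two approximators have size `≤ c` (CKR, proof of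
Lemma 2.18: "since `f` and `g` are trimmed"). [cite: CavalarKumarRossman2022, Lemma 2.18] -/
theorem card_le_of_mem_minimals_union_inter {𝒜 ℬ : Finset (Finset V)} (h𝒜 : IsApprox c ε 𝒜)
    (hℬ : IsApprox c ε ℬ) :
    (∀ A ∈ minimals (𝒜 ∪ ℬ), #A ≤ c) ∧ (∀ A ∈ minimals (𝒜 ∩ ℬ), #A ≤ c) := by
  constructor
  · intro A hA
    rcases minimals_union hA with h | h
    · exact (h𝒜.card_le_of_mem_minimals h).trans (Nat.div_le_self c 2)
    · exact (hℬ.card_le_of_mem_minimals h).trans (Nat.div_le_self c 2)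
  · intro A hA
    obtain ⟨M₁, hM₁, M₂, hM₂, rfl⟩ := minimals_inter h𝒜.isUpperSet hℬ.isUpperSet hA
    have h1 := h𝒜.card_le_of_mem_minimals hM₁
    have h2 := hℬ.card_le_of_mem_minimals hM₂
    calc #(M₁ ∪ M₂) ≤ #M₁ + #M₂ := card_union_le _ _
      _ ≤ c / 2 + c / 2 := Nat.add_le_add h1 h2
      _ ≤ c := by omega

end Scheme

/-! ### Errors on the positive test inputs -/

section Positive

variable {n : ℕ} [Fact n.Prime] {c k : ℕ} {ε : ℝ}

/-- **Few test sets through the minterms of a closed function** (CKR, proofs of Lemmas 2.17 and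
2.18, combining Lemma 2.5 with Lemma 2.11): for a closed up-set `𝒯` and sizes `ℓ ∈ L ⊆ [1, c]`,
`∑_{A ∈ min 𝒯, |A| ∈ L} Pr[A ⊆ S_𝐘] ≤ ∑_{ℓ ∈ L} |M_ℓ(𝒯)| (k/n)^ℓ ≤ ∑_{ℓ ∈ L} 3^{-ℓ}` under the
parameter hypothesis `2 B log(c/ε) · k/n ≤ 1/3`. [cite: CavalarKumarRossman2022, Lemma 2.17] -/
theorem sum_card_filter_subset_hrSet_le (hkn : k < n) (hε0 : 0 < ε) (hε1 : ε ≤ 1 / 2)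
    (hH : 2 * spreadConst * Real.log (c / ε) * k / n ≤ 1 / 3) {𝒯 : Finset (Finset (ZMod n))}
    (hup : IsUpperSet (𝒯 : Set (Finset (ZMod n)))) (hcl : IsClosedFam c ε 𝒯) (L : Finset ℕ)
    (hL : ∀ ℓ ∈ L, 1 ≤ ℓ ∧ ℓ ≤ c) :
    ∑ A ∈ (minimals 𝒯).filter (fun A => #A ∈ L),
        (#(univ.filter fun v : Fin c → ZMod n => A ⊆ hrSet k v) : ℝ) / n ^ c
      ≤ ∑ ℓ ∈ L, (1 / 3 : ℝ) ^ ℓ := by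
  have hn : (0 : ℝ) < n := by exact_mod_cast (Fact.out : n.Prime).pos
  have hB := spreadConst_pos
  rw [← sum_fiberwise_of_maps_to (s := (minimals 𝒯).filter fun A => #A ∈ L) (t := L)
    (g := card) fun A hA => (mem_filter.1 hA).2]
  refine sum_le_sum fun ℓ hℓ => ?_
  obtain ⟨hℓ1, hℓc⟩ := hL ℓ hℓ
  -- each term: `Pr[A ⊆ S_v] ≤ (k/n)^ℓ`
  have hterm : ∀ A ∈ ((minimals 𝒯).filter fun A => #A ∈ L).filter (fun A => #A = ℓ),
      (#(univ.filter fun v : Fin c → ZMod n => A ⊆ hrSet k v) : ℝ) / n ^ c ≤ ((k : ℝ) / n) ^ ℓ := by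
    intro A hA
    have hAℓ : #A = ℓ := (mem_filter.1 hA).2
    have h := card_filter_subset_hrSet_mul_le (c := c) hkn A (by omega)
    rw [hAℓ] at h
    have h' : (#(univ.filter fun v : Fin c → ZMod n => A ⊆ hrSet k v) : ℝ) * n ^ ℓ ≤ k ^ ℓ * n ^ c := by
      exact_mod_cast h
    rw [div_pow, div_le_div_iff₀ (by positivity) (by positivity)]
    linarith
  -- the number of `ℓ`-minterms
  have hset : ((minimals 𝒯).filter fun A => #A ∈ L).filter (fun A => #A = ℓ)
      = (minimals 𝒯).filter fun A => #A = ℓ := by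
    ext A
    simp only [mem_filter]
    constructor
    · rintro ⟨⟨h1, -⟩, h3⟩; exact ⟨h1, h3⟩
    · rintro ⟨h1, h3⟩; exact ⟨⟨h1, h3 ▸ hℓ⟩, h3⟩
  have hcount := card_minimals_filter_card_eq_le hup hcl hε0 hε1 hℓ1 hℓc
  -- `log(ℓ/ε) ≤ log(c/ε)`
  have hρ0 : 0 ≤ 2 * spreadConst * Real.log (ℓ / ε) := by
    have : 0 ≤ Real.log (ℓ / ε) := by
      apply Real.log_nonneg
      rw [le_div_iff₀ hε0]
      have : (1 : ℝ) ≤ ℓ := by exact_mod_cast hℓ1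
      linarith
    positivity
  have hρle : 2 * spreadConst * Real.log (ℓ / ε) ≤ 2 * spreadConst * Real.log (c / ε) := by
    have hℓc' : (ℓ : ℝ) ≤ c := by exact_mod_cast hℓc
    have : Real.log (ℓ / ε) ≤ Real.log (c / ε) :=
      Real.log_le_log (by positivity) (div_le_div_of_nonneg_right hℓc' hε0.le)
    nlinarith
  have hρk : 2 * spreadConst * Real.log (c / ε) * ((k : ℝ) / n) ≤ 1 / 3 := by
    rw [← mul_div_assoc]; exact hH
  calc ∑ A ∈ ((minimals 𝒯).filter fun A => #A ∈ L).filter (fun A => #A = ℓ),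
        (#(univ.filter fun v : Fin c → ZMod n => A ⊆ hrSet k v) : ℝ) / n ^ c
      ≤ ∑ A ∈ ((minimals 𝒯).filter fun A => #A ∈ L).filter (fun A => #A = ℓ), ((k : ℝ) / n) ^ ℓ :=
        sum_le_sum hterm
    _ = #((minimals 𝒯).filter fun A => #A = ℓ) * ((k : ℝ) / n) ^ ℓ := by
        rw [sum_const, nsmul_eq_mul, hset]
    _ ≤ (2 * spreadConst * Real.log (ℓ / ε)) ^ ℓ * ((k : ℝ) / n) ^ ℓ :=
        mul_le_mul_of_nonneg_right hcount (by positivity)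
    _ ≤ (2 * spreadConst * Real.log (c / ε)) ^ ℓ * ((k : ℝ) / n) ^ ℓ :=
        mul_le_mul_of_nonneg_right (pow_le_pow_left₀ hρ0 hρle ℓ) (by positivity)
    _ = (2 * spreadConst * Real.log (c / ε) * ((k : ℝ) / n)) ^ ℓ := by ring
    _ ≤ (1 / 3 : ℝ) ^ ℓ :=
        pow_le_pow_left₀ (mul_nonneg (hρ0.trans hρle) (by positivity)) hρk ℓ

/-- **Approximation loses little positive weight** (CKR Lemma 2.16 + Lemma 2.11, as in the proof
of Lemma 2.18): if the up-set `ℋ` has all minterms of size `≤ c` then the test vectors `v` with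
`S_v ∈ ℋ` but `S_v ∉ trim(cl(ℋ))` have weight `≤ ∑_{c/2 < ℓ ≤ c} 3^{-ℓ} ≤ ½ 3^{-⌊c/2⌋}`.
[cite: CavalarKumarRossman2022, Lemma 2.18] -/
theorem sum_lost_le (hc : 2 ≤ c) (hkn : k < n) (hε0 : 0 < ε) (hε1 : ε ≤ 1 / 2)
    (hH : 2 * spreadConst * Real.log (c / ε) * k / n ≤ 1 / 3) {ℋ : Finset (Finset (ZMod n))}
    (hℋ : ∀ A ∈ minimals ℋ, #A ≤ c) :
    ∑ _v ∈ univ.filter (fun v : Fin c → ZMod n => hrSet k v ∈ ℋ ∧ hrSet k v ∉ trim c (closure c ε ℋ)),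
        (1 / n ^ c : ℝ) ≤ 1 / 2 * (1 / 3 : ℝ) ^ (c / 2) := by
  have hn : (0 : ℝ) < n := by exact_mod_cast (Fact.out : n.Prime).pos
  set 𝓜 := (minimals (closure c ε ℋ)).filter fun A => #A ∈ Ioc (c / 2) c with h𝓜
  -- containment in the union of the events `A ⊆ S_v`
  have hcover : (univ.filter fun v : Fin c → ZMod n => hrSet k v ∈ ℋ ∧ hrSet k v ∉ trim c (closure c ε ℋ))
      ⊆ 𝓜.biUnion fun A => univ.filter fun v : Fin c → ZMod n => A ⊆ hrSet k v := by
    intro v hv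
    obtain ⟨h1, h2⟩ := (mem_filter.1 hv).2
    obtain ⟨A, hA, hgt, hle, hAv⟩ := exists_minimal_of_mem_of_not_mem_trim hℋ h1 h2
    exact mem_biUnion.2 ⟨A, mem_filter.2 ⟨hA, mem_Ioc.2 ⟨hgt, hle⟩⟩, mem_filter.2 ⟨mem_univ _, hAv⟩⟩
  have hsizes : ∀ ℓ ∈ Ioc (c / 2) c, 1 ≤ ℓ ∧ ℓ ≤ c := fun ℓ hℓ => by
    rw [mem_Ioc] at hℓ; omega
  have hmain := sum_card_filter_subset_hrSet_le hkn hε0 hε1 hH (isUpperSet_closure c ε ℋ)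
    (isClosedFam_closure c ε ℋ) (Ioc (c / 2) c) hsizes
  -- geometric tail
  have hgeom : ∑ ℓ ∈ Ioc (c / 2) c, (1 / 3 : ℝ) ^ ℓ ≤ 1 / 2 * (1 / 3 : ℝ) ^ (c / 2) := by
    have hIoc : Ioc (c / 2) c = Ico (c / 2 + 1) (c + 1) := by
      ext ℓ; simp only [mem_Ioc, mem_Ico]; omega
    rw [hIoc]
    refine (geom_sum_Ico_le_of_lt_one (by norm_num) (by norm_num)).trans (le_of_eq ?_)
    rw [pow_succ]
    ring
  calc ∑ _v ∈ univ.filter (fun v : Fin c → ZMod n => hrSet k v ∈ ℋ ∧ hrSet k v ∉ trim c (closure c ε ℋ)),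
        (1 / n ^ c : ℝ)
      = #(univ.filter fun v : Fin c → ZMod n => hrSet k v ∈ ℋ ∧ hrSet k v ∉ trim c (closure c ε ℋ))
          * (1 / n ^ c : ℝ) := by rw [sum_const, nsmul_eq_mul]
    _ ≤ (∑ A ∈ 𝓜, (#(univ.filter fun v : Fin c → ZMod n => A ⊆ hrSet k v) : ℝ)) * (1 / n ^ c) := by
        refine mul_le_mul_of_nonneg_right ?_ (by positivity)
        exact_mod_cast (card_le_card hcover).trans card_biUnion_le
    _ = ∑ A ∈ 𝓜, (#(univ.filter fun v : Fin c → ZMod n => A ⊆ hrSet k v) : ℝ) / n ^ c := by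
        rw [sum_mul]; exact sum_congr rfl fun A _ => by ring
    _ ≤ ∑ ℓ ∈ Ioc (c / 2) c, (1 / 3 : ℝ) ^ ℓ := hmain
    _ ≤ 1 / 2 * (1 / 3 : ℝ) ^ (c / 2) := hgeom

/-- **An approximate OR loses little positive weight** (CKR Lemma 2.18, positive part).
[cite: CavalarKumarRossman2022, Lemma 2.18] -/
theorem sum_lostSup_le (hc : 2 ≤ c) (hε : ε ≤ 1 / 2) (hkn : k < n) (hε0 : 0 < ε)
    (hH : 2 * spreadConst * Real.log (c / ε) * k / n ≤ 1 / 3) {𝒜 ℬ : Finset (Finset (ZMod n))}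
    (h𝒜 : IsApprox c ε 𝒜) (hℬ : IsApprox c ε ℬ) :
    ∑ _v ∈ (scheme c ε hc hε).lostSup univ (fun v : Fin c → ZMod n => finsetEquivFun (hrSet k v)) 𝒜 ℬ,
        (1 / n ^ c : ℝ) ≤ 1 / 2 * (1 / 3 : ℝ) ^ (c / 2) := by
  refine le_trans ?_ (sum_lost_le hc hkn hε0 hε hH (card_le_of_mem_minimals_union_inter h𝒜 hℬ).1)
  refine sum_le_sum_of_subset_of_nonneg (fun _ hv => ?_) fun _ _ _ => by positivity
  obtain ⟨-, h⟩ := mem_filter.1 hv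
  simp only [scheme_val_finsetEquivFun, Bool.or_eq_true, decide_eq_true_eq,
    decide_eq_false_iff_not] at h
  refine mem_filter.2 ⟨mem_univ _, ?_, h.2⟩
  rcases h.1 with h' | h'
  · exact mem_union_left _ h'
  · exact mem_union_right _ h'

/-- **An approximate AND loses little positive weight** (CKR Lemma 2.18, positive part).
[cite: CavalarKumarRossman2022, Lemma 2.18] -/
theorem sum_lostInf_le (hc : 2 ≤ c) (hε : ε ≤ 1 / 2) (hkn : k < n) (hε0 : 0 < ε)
    (hH : 2 * spreadConst * Real.log (c / ε) * k / n ≤ 1 / 3) {𝒜 ℬ : Finset (Finset (ZMod n))}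
    (h𝒜 : IsApprox c ε 𝒜) (hℬ : IsApprox c ε ℬ) :
    ∑ _v ∈ (scheme c ε hc hε).lostInf univ (fun v : Fin c → ZMod n => finsetEquivFun (hrSet k v)) 𝒜 ℬ,
        (1 / n ^ c : ℝ) ≤ 1 / 2 * (1 / 3 : ℝ) ^ (c / 2) := by
  refine le_trans ?_ (sum_lost_le hc hkn hε0 hε hH (card_le_of_mem_minimals_union_inter h𝒜 hℬ).2)
  refine sum_le_sum_of_subset_of_nonneg (fun _ hv => ?_) fun _ _ _ => by positivity
  obtain ⟨-, h⟩ := mem_filter.1 hv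
  simp only [scheme_val_finsetEquivFun, Bool.and_eq_true, decide_eq_true_eq,
    decide_eq_false_iff_not] at h
  exact mem_filter.2 ⟨mem_univ _, mem_inter.2 h.1, h.2⟩

/-- **CKR Lemma 2.17** (approximators make many errors, positive part): an approximator not
containing `∅` (i.e. `≢ 1`) accepts the positive test input with probability
`≤ ∑_{1 ≤ ℓ ≤ c/2} |M_ℓ| (k/n)^ℓ ≤ ∑_{ℓ ≥ 1} 3^{-ℓ} ≤ 1/2`. [cite: CavalarKumarRossman2022, Lemma 2.17] -/
theorem sum_filter_mem_le_half (hkn : k < n) (hε0 : 0 < ε) (hε1 : ε ≤ 1 / 2)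
    (hH : 2 * spreadConst * Real.log (c / ε) * k / n ≤ 1 / 3) {𝒜 : Finset (Finset (ZMod n))}
    (h𝒜 : IsApprox c ε 𝒜) (h0 : ∅ ∉ 𝒜) :
    ∑ _v ∈ univ.filter (fun v : Fin c → ZMod n => hrSet k v ∈ 𝒜), (1 / n ^ c : ℝ) ≤ 1 / 2 := by
  have hn : (0 : ℝ) < n := by exact_mod_cast (Fact.out : n.Prime).pos
  obtain ⟨𝒯, hup, hcl, rfl⟩ := h𝒜
  set 𝓜 := (minimals 𝒯).filter fun A => #A ∈ Icc 1 (c / 2) with h𝓜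
  have hcover : (univ.filter fun v : Fin c → ZMod n => hrSet k v ∈ trim c 𝒯)
      ⊆ 𝓜.biUnion fun A => univ.filter fun v : Fin c → ZMod n => A ⊆ hrSet k v := by
    intro v hv
    obtain ⟨A, hA, h1, h2, hAv⟩ := exists_minimal_of_mem_trim h0 (mem_filter.1 hv).2
    exact mem_biUnion.2 ⟨A, mem_filter.2 ⟨hA, mem_Icc.2 ⟨h1, h2⟩⟩, mem_filter.2 ⟨mem_univ _, hAv⟩⟩
  have hsizes : ∀ ℓ ∈ Icc 1 (c / 2), 1 ≤ ℓ ∧ ℓ ≤ c := fun ℓ hℓ => by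
    rw [mem_Icc] at hℓ; omega
  have hmain := sum_card_filter_subset_hrSet_le hkn hε0 hε1 hH hup hcl (Icc 1 (c / 2)) hsizes
  have hgeom : ∑ ℓ ∈ Icc 1 (c / 2), (1 / 3 : ℝ) ^ ℓ ≤ 1 / 2 := by
    have hIcc : Icc 1 (c / 2) = Ico 1 (c / 2 + 1) := by
      ext ℓ; simp only [mem_Icc, mem_Ico]; omega
    rw [hIcc]
    refine (geom_sum_Ico_le_of_lt_one (by norm_num) (by norm_num)).trans ?_
    norm_num
  calc ∑ _v ∈ univ.filter (fun v : Fin c → ZMod n => hrSet k v ∈ trim c 𝒯), (1 / n ^ c : ℝ)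
      = #(univ.filter fun v : Fin c → ZMod n => hrSet k v ∈ trim c 𝒯) * (1 / n ^ c : ℝ) := by
        rw [sum_const, nsmul_eq_mul]
    _ ≤ (∑ A ∈ 𝓜, (#(univ.filter fun v : Fin c → ZMod n => A ⊆ hrSet k v) : ℝ)) * (1 / n ^ c) := by
        refine mul_le_mul_of_nonneg_right ?_ (by positivity)
        exact_mod_cast (card_le_card hcover).trans card_biUnion_le
    _ = ∑ A ∈ 𝓜, (#(univ.filter fun v : Fin c → ZMod n => A ⊆ hrSet k v) : ℝ) / n ^ c := by
        rw [sum_mul]; exact sum_congr rfl fun A _ => by ring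
    _ ≤ ∑ ℓ ∈ Icc 1 (c / 2), (1 / 3 : ℝ) ^ ℓ := hmain
    _ ≤ 1 / 2 := hgeom

end Positive

end Literature.Computability.Complexity.CKR
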